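import Literature.AlgebraicGeometry.HodgeTheory.MotivatedClasses
import Literature.AlgebraicGeometry.HodgeTheory.GysinBaseChange
import HarnessLib

/-!
# André's motivated Galois group `G_mot(X)` and the Mumford–Tate group `MT(X)` on the real carriers, Tannaka-free: stabilisers of the motivated (resp. Hodge) classes on all powers of `X`

Family `hodge`, layer `Literature/AlgebraicGeometry/HodgeTheory` (definition request
`defn-MotivatedGaloisGroup` of route `HodgeConjecture/MotivatedLefschetzSplit`, crux
`HodgeClassesMotivated`, card `dynkin-menu-intermediate-groups`). Y. André, *Pour une théorie
inconditionnelle des motifs*, Publ. Math. IHÉS 83 (1996), proves (Thm. 0.4, p. 8) that the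
`⊗`-category `𝓜(𝒱)` of motives modelled on a family `𝒱` of smooth projective varieties, built from
MOTIVATED correspondences, is Tannakian, graded, semisimple and polarised, and defines (§4.6,
Définition, p. 24) the **motivic Galois group** `G_𝒱 = Aut^⊗(H_B | 𝓜(𝒱))`, "un groupe proalgébrique,
muni d'un homomorphisme central `w : 𝔾_m → G_𝒱` (du fait que `𝓜(𝒱)` est graduée)"; for a motive
`M`, `G_𝒱` acts on `H_B(M)` through an algebraic group `G(M)` and (ibid.):
"(i) `G(M)` est proréductif (du fait que `𝓜(𝒱)` est semi-simple); (ii) `G(M)` est le sous-groupe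
algébrique de `GL(H_B(M))` qui fixe les cycles motivés parmi les tenseurs mixtes sur `H_B(M)`;
réciproquement, tout tenseur mixte sur `H_B(M)` fixé par `G(M)` est motivé"; Remarque (ii)
(p. 25): "Même dans le contexte des cycles de Hodge absolus, et pour `K = ℂ`, la connexité des
groupes de Galois motiviques ne semble pas connue"; §6.2 (p. 31): "Pour `K ⊆ ℂ` et `H = H_B`,
`G_H(A)` contient le groupe de Mumford–Tate". On the Hodge side (P. Deligne, *Hodge cycles on
abelian varieties*, LNM 900 (1982), I §3): the Mumford–Tate group of a rational Hodge structure
`V` is the subgroup of `GL(V) × 𝔾_m` fixing the rational tensors of type `(0,0)` in the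
`V^{⊗m₁} ⊗ V^{∨⊗m₂} ⊗ ℚ(1)^{⊗m₃}` (definition preceding Prop. 3.4), reductive for `V` polarisable
(Prop. 3.6); and Chevalley's theorem in the form of Prop. 3.1 (c): a REDUCTIVE subgroup
`H ≤ GL(V)` is the subgroup fixing the tensors it fixes.

The tree has André's group over an ABSTRACT Weil cohomology in elementary points form
(`Motives.WeilCohomology.motivatedAut`, file `Motives/MotivatedAut`) and as the abstract-subgroup
counting predicate `Motives.Andre1996_motivatedGaloisGroup_tannakianCounts`
(`Motives/MotivatedGaloisGroupCounts`), and the Mumford–Tate group of an ABSTRACT pure `ℚ`-Hodge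
structure (`Motives.HodgeStructure.mumfordTateGroup`, `.hodgeGroup`, file `Motives/HodgeTensor`).
This file puts both groups on the REAL CARRIERS of the summit statement — the complex Betti
cohomology `complexBetti X k = Hᵏ(X(ℂ); ℂ)` with its motivated classes
`motivatedClasses n X p = A_motᵖ(X)_ℂ` (`HodgeTheory/MotivatedClasses`, André Déf. 1) and its
rational `(p,p)`-classes (`IsRationalClass`, `IsOfHodgeType`, `HodgeTheory/RationalHodgeClasses`) —
WITHOUT Tannakian reconstruction (absent from Mathlib), as requested: as the groups of families
`g = (g_k ∈ GL(Hᵏ(X(ℂ); ℂ)))_k` whose diagonal (Künneth) extension to the powers `X^{×a}` fixes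
every motivated (resp. rational Hodge) class of every power, possibly up to the Tate character.

## Content

* `cartesianPow X a = X^{×a}` (`𝟙, X, X ⊗ X, (X ⊗ X) ⊗ X, …`; `X^{×1} = X` ON THE NOSE),
  `cartesianPowDim n a = (a + 1) n` (`= dim X^{×(a+1)}`), `isSmoothProjective_cartesianPow`.
* `IsKunnethFamily X G` — a family `G = (G_{a,k} ∈ GL(Hᵏ(X^{×(a+1)}(ℂ); ℂ)))` **is the diagonal
  extension of `G_0 = g`**: `G_{a+1}(pr₁^* x ∪ pr₂^* y) = pr₁^*(G_a x) ∪ pr₂^*(G_0 y)` on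
  `X^{×(a+2)} = X^{×(a+1)} ⊗ X`. By the Künneth theorem (cross products span,
  `kunnethSpan_complexBetti`) such a family is determined by `g` (`IsKunnethFamily.ext_of_apply_zero`,
  proved): it is "`g^{⊗(a+1)}` read through Künneth", the action of `g ∈ GL(H_B(X))` on the mixed
  tensors `H_B(X)^{⊗(a+1)} = H_B(X^{a+1})`.
* `powClassStabilizer X S` — for a system `S = (S_{a,p} ⊆ H²ᵖ(X^{×(a+1)}(ℂ); ℂ))` of classes on
  the powers, the subgroup of the `g` some (= the) Künneth family of which FIXES every class of
  `S`; `powClassSimilitudeGroup X S` — the same up to a Tate character: `G_a ξ = cᵖ ξ` for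
  `ξ ∈ S_{a,p}`, one `c ∈ ℂˣ` for all `a`, `p`. Proved: group laws, monotonicity, invariance under
  passing to spans, `powClassStabilizer ≤ powClassSimilitudeGroup`, the weight cocharacter
  `weightCocharacter X λ = (λᵏ on Hᵏ)_k` lies in every similitude group, and the decomposition
  **`Sim(S) = w(ℂˣ) · Stab(S)`** (`mem_powClassSimilitudeGroup_iff_exists_weightCocharacter_mul`).
* **`motivatedGaloisGroup n X`** (`G_mot(X)(ℂ)`) and **`specialMotivatedGaloisGroup n X`**
  (`G¹_mot(X)(ℂ)`, the kernel of the Tate character): the similitude group, resp. stabiliser, of the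
  system `motivatedPowClasses n X = (A_motᵖ(X^{×(a+1)})_ℂ)_{a,p}`.
* **`mumfordTateGroup n X`** (`MT(X)(ℂ)`) and **`hodgeGroup n X`** (`Hg(X)(ℂ)`, special
  Mumford–Tate group): the same for the system `hodgePowClasses n X` of RATIONAL classes of Hodge
  type `(p,p)` on the powers.
* `neutralComponent K`, `IsNeutral K` (connectedness), `numComponents K` (`#π₀`) for a subgroup `K`
  of any group: the intersection of the finite-index subgroups of `K` (see "Connectedness").
* Named facts (D-0014), both CONSEQUENCES of the printed theorems for these renderings (see
  "Identification"): `Andre1996_motivatedClasses_le_span_hodgeClasses` (§2.5 c): motivated classes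
  are `ℂ`-combinations of rational `(p,p)`-classes) and
  `Andre1996_specialMotivatedGaloisGroup_invariants_le` (§4.6 (ii): a class of `H²ᵖ(X(ℂ); ℂ)`
  fixed by `G¹_mot(X)(ℂ)` is motivated).
* Proved API for the route: `MT(X) ≤ G_mot(X)` and `Hg(X) ≤ G¹_mot(X)` from the first fact
  (`mumfordTateGroup_le_motivatedGaloisGroup`, André §6.2 p. 31 on the real carriers); motivated
  classes are fixed by `G¹_mot` (definitional direction of (ii)); **"Hodge ⇒ motivated on all powers
  of `X`" ⇒ `Hg(X) = G¹_mot(X)` ⇒ (second fact) "Hodge ⇒ motivated on `X`"**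
  (`hodgeGroup_eq_specialMotivatedGaloisGroup_of_forall_mem_motivatedClasses`,
  `mem_motivatedClasses_of_hodgeGroup_eq`) — the Tannakian reformulation
  "`HM ⟺ MT = G_mot ⟺ [G_mot connected] ∧ [MT = G_mot⁰]`" the route foresees, in its two provable
  directions; the equivalence `MT = G_mot ⟺ Hg = G¹_mot` is `w(ℂˣ) · (–)` applied to both sides
  (`mumfordTateGroup_eq_motivatedGaloisGroup_of_hodgeGroup_eq`).

## Identification with the printed groups (what a reviewer must accept; not formalised)

Let `X` be smooth projective over `ℂ` of dimension `n ≥ 1` (for `n = 0` everything is trivial),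
`H = H^*_B(X, ℚ) = ⊕ₖ Hᵏ`, `M = h(X)`, `G = G(M) ≤ GL(H)` André's group, `χ : G → 𝔾_m` the character
by which `G` acts on `H_B(𝟙(1))` (`𝟙(-1)` is a direct factor of `h²(X)`, the line of a polarisation,
by semisimplicity), `G¹ = ker χ`, `w : 𝔾_m → G` the weight cocharacter (`w(λ) = λᵏ` on `Hᵏ`).
(a) A motivated class `ξ ∈ A_motᵖ(X^a) = Hom(𝟙(-p), h(X^a))` (§4.1: "on regarde les cycles motivés
de `A_mot(X)` comme des éléments de `H²ᵖ(X)(p)`") is multiplied by `χ(g)⁻ᵖ` under `g ∈ G(ℂ)`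
acting on `H(X^a) = H^{⊗a}` (Künneth = the tensor structure of `H_B`, §4.3–4.4); so `G(ℂ) ⊆
motivatedGaloisGroup` (with `c = χ(g)⁻¹`) and `G¹(ℂ) ⊆ specialMotivatedGaloisGroup`. (b) Conversely
let `g ∈ specialMotivatedGaloisGroup`. The class of the diagonal `[Δ] ∈ H²ⁿ(X × X)` is algebraic,
hence motivated ("il est clair que `A_mot(X)_E` contient `A(X)`", §2.1), hence fixed by `g ⊗ g`, which
says that `g` preserves the Poincaré pairing; through `h(X)^∨ ≅ h(X)(n)` (§4.3) the mixed tensor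
spaces `H^{⊗a} ⊗ H^{∨⊗b}` become `H(X^{a+b})` Tate-twisted, `g`-equivariantly, and their `G`-fixed
tensors become motivated classes (ii), which `g` fixes; `G` being reductive ((i)), Chevalley's theorem
(Deligne I Prop. 3.1 (c)) gives `g ∈ G(ℂ)`, and `χ(g) = 1` because `g` fixes the (motivated)
polarisation class in `H²(X)`. Hence **`specialMotivatedGaloisGroup n X = G¹(ℂ)`** and, by
`G(ℂ) = w(ℂˣ) · G¹(ℂ)` (`χ ∘ w = (·)⁻²` is surjective on `ℂˣ`) and the proved decomposition,
**`motivatedGaloisGroup n X = G(ℂ)`**. (c) Likewise, with Deligne I §3 (definition, Prop. 3.4,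
Prop. 3.6 — `H` is polarisable — and Prop. 3.1 (c), the polarisation forms being Hodge classes on
`X × X`): **`mumfordTateGroup n X = MT(H)(ℂ)`** and **`hodgeGroup n X = Hg(H)(ℂ)`** (the special
Mumford–Tate group `G⁰ = Ker(G → 𝔾_m)` of Deligne I §3, proof of Thm. 3.8 ff.), both acting diagonally
on `⊕ₖ Hᵏ ⊗ ℂ`.
(d) `ℂ`-coefficients: `A_mot(X)_ℂ = A_mot(X)_ℚ ⊗ ℂ` (Prop. 3.2.1 with Prop. 3.3, `Q = ℚ`), and the
rational `(p,p)`-classes span the `ℂ`-points of the `ℚ`-space of Hodge classes; fixing a set or its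
`ℂ`-span is the same condition (`powClassStabilizer_span`). (e) Under (a)–(b) the second named fact
is (ii) for `M = h(X)` and the tensor space `H²ᵖ(X)(p)`: a vector of `H²ᵖ(X) ⊗ ℂ` fixed by `G¹(ℂ)`
(Zariski-dense in `G¹_ℂ`) spans a sum of `χʲ`-isotypic lines of `G`, and `w(𝔾_m) ≤ G` acting on
`H²ᵖ` by `λ²ᵖ` singles out the one character by which `G` acts on `H_B(𝟙(-p))`, i.e. the vector is
a `G`-fixed element of `H²ᵖ(X)(p) ⊗ ℂ`, i.e. motivated; only the inclusion
`G¹(ℂ) ⊆ specialMotivatedGaloisGroup` of (a) is used, not Chevalley.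

## Connectedness (the rendering of `G⁰` and `π₀`)

For the group `K = 𝒢(ℂ)` of `ℂ`-points of a linear algebraic group `𝒢` over `ℂ` — the case of all
four groups here, cut out of `∏ₖ GL(Hᵏ ⊗ ℂ)` by polynomial equations (and an image of such under
`𝔾_m × (–)`) — the identity component is recovered from the ABSTRACT group: `𝒢⁰(ℂ)` has finite index
and has NO proper subgroup of finite index (every element of a connected linear algebraic group
over an algebraically closed field of characteristic `0` is a product of an element of a torus and a
unipotent element, `g = g_s g_u`, both lying in divisible abelian subgroups `(ℂˣ)ʳ`, `exp(ℂ N)`, and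
a divisible group has trivial image in every finite quotient), so `𝒢⁰(ℂ)` is the intersection of the
finite-index subgroups of `𝒢(ℂ)` = `neutralComponent K`, `π₀(𝒢) = K / neutralComponent K`, and
`𝒢` is connected iff `K` has no proper finite-index subgroup (`IsNeutral K`). This is the same
abstract shadow of connectedness as `Motives.FiniteIndexSubgroupsFixSameTensors` (file
`Motives/MotivatedGaloisGroupCounts`). For an arbitrary abstract `K` the three notions are what
they are (junk-free but uninteresting). André, Remarque (ii) p. 25: connectedness of `G(M)` is NOT
known; no fact about it is stated here.

## Design and what is NOT here

* Ambient group: the per-degree product `∏ₖ GL(Hᵏ(X(ℂ); ℂ))` (Mathlib's `Pi.group` over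
  `LinearEquiv.automorphismGroup`: `(f * g) x = f (g x)`, `⇑f⁻¹ = ⇑f.symm`), as in
  `Motives/MotivatedAut`, rather than `GL(⊕ₖ Hᵏ)`: `G` preserves the grading (the Künneth
  projectors are motivated correspondences, André Prop. 1.2 / §4.3), so nothing is lost, and the
  degreewise form is the one the layer's carriers `complexBetti X k` support directly.
* Powers: `X^{×(a+1)}` with `X^{×1} = X` definitionally, so that the `a = 0` member of a Künneth
  family IS an automorphism of `H^*(X(ℂ); ℂ)` and the `a = 0` instances of the class systems ARE
  `motivatedClasses n X p` / the rational `(p,p)`-classes of `X` (no transport); dimensions through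
  `cartesianPowDim n a` (`= (a+1) n`, definitionally `n` at `a = 0` and `cartesianPowDim n a + n` at
  `a + 1`, the shape of `IsSmoothProjective.tensor_holds`).
* `ℂ`-points, not `ℚ`-points: the carriers are complex vector spaces; `G(ℂ)` determines `G`.
* Existence of the Künneth family of an arbitrary `g` (Künneth injectivity,
  `complexBetti_kunneth_bijective`) is not needed and not proved; uniqueness is.
* Not here: reductivity of `G_mot` (André §4.6 (i)) and of `MT` (Deligne I 3.6) in any rendering;
  the identifications (b), (c) above; `G_mot(X^a)` versus `G_mot(X)`; finiteness of `π₀`.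
* Mathlib has no Mumford–Tate groups, motives, motivic Galois groups or Tannakian categories
  (searched `MumfordTate`, `motivic`, `Tannaka`, `identityComponent`: only `Literature` material —
  `Motives/HodgeTensor`, `Motives/MotivatedAut`, `NumberTheory/Automorphic/IdentityComponent` for
  `GL n k` with Zariski-closed subgroups, a different ambient group).

## References

* [Andre1996Motifs] Y. André, Pour une théorie inconditionnelle des motifs, Publ. Math. IHÉS 83
  (1996) 5–49: Thm. 0.4 (p. 8); §2.1 Déf. 1 and remark (p. 14); §2.5 c) and Prop. 2.5.1 (p. 18);
  Prop. 3.2.1 (p. 20), Prop. 3.3 (p. 21); §4.1–4.4 (pp. 22–23); §4.6 Définition, (i)–(iii) (p. 24),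
  Remarques (i)–(ii) (p. 25); §6.2 (p. 31), §6.3 (p. 31: "En remplaçant `A` par ses puissances, on
  en déduit que `G_mot(A)` coïncide avec `G_MT(A)`").
* [Deligne1982HodgeCycles] P. Deligne, Hodge cycles on abelian varieties (notes by J. S. Milne),
  LNM 900 (1982): I Prop. 3.1, §3 definition of the Mumford–Tate group (preceding Prop. 3.4),
  Prop. 3.4, 3.6, the special Mumford–Tate group `G⁰ = Ker(G → 𝔾_m)` (before Thm. 3.8).
* [Moonen2004MT] B. Moonen, An introduction to Mumford–Tate groups (2004), §4–5.
* [HatcherAT2002] A. Hatcher, Algebraic Topology, §3.2 Thm. 3.15–3.16 (Künneth).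
-/

noncomputable section

open CategoryTheory AlgebraicGeometry MonoidalCategory CartesianMonoidalCategory
open Literature.AlgebraicTopology.SingularHomology

namespace Literature.AlgebraicGeometry.HodgeTheory

section HodgeTheory

/-! ### Powers `X^{×a}` -/

/-- The cartesian powers `X^{×a}` of a `ℂ`-scheme in the cartesian monoidal category of
`ℂ`-schemes: `X^{×0} = 𝟙 = Spec ℂ`, `X^{×1} = X` (on the nose), `X^{×(a+2)} = X^{×(a+1)} ⊗ X`.
(The tree's `Motives.schemePow X k = (⋯(𝟙 ⊗ X) ⊗ ⋯) ⊗ X` has first power `𝟙 ⊗ X ≇ X`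
definitionally; here the first power must be `X` itself, see the module docstring.) [folklore] -/
def cartesianPow (X : Motives.SchemeOver ℂ) : ℕ → Motives.SchemeOver ℂ
  | 0 => 𝟙_ (Motives.SchemeOver ℂ)
  | 1 => X
  | a + 2 => cartesianPow X (a + 1) ⊗ X

/-- The dimension `(a + 1) n` of `X^{×(a+1)}` for `X` of dimension `n`, as the recursion
`n, n + n, (n + n) + n, …` matching `IsSmoothProjective.tensor_holds`. [folklore] -/
def cartesianPowDim (n : ℕ) : ℕ → ℕ
  | 0 => n
  | a + 1 => cartesianPowDim n a + n

variable {n : ℕ} {X : Motives.SchemeOver ℂ}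

/-- `X^{×0} = 𝟙`. [folklore] -/
@[simp] theorem cartesianPow_zero : cartesianPow X 0 = 𝟙_ (Motives.SchemeOver ℂ) := rfl

/-- `X^{×1} = X`. [folklore] -/
@[simp] theorem cartesianPow_one : cartesianPow X 1 = X := rfl

/-- `X^{×(a+2)} = X^{×(a+1)} ⊗ X`. [folklore] -/
theorem cartesianPow_succ_succ (a : ℕ) : cartesianPow X (a + 2) = cartesianPow X (a + 1) ⊗ X := rfl

/-- `cartesianPowDim n 0 = n`. [folklore] -/
@[simp] theorem cartesianPowDim_zero : cartesianPowDim n 0 = n := rfl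

/-- `cartesianPowDim n (a + 1) = cartesianPowDim n a + n`. [folklore] -/
theorem cartesianPowDim_succ (a : ℕ) : cartesianPowDim n (a + 1) = cartesianPowDim n a + n := rfl

/-- `cartesianPowDim n a = (a + 1) n`. [folklore] -/
theorem cartesianPowDim_eq (a : ℕ) : cartesianPowDim n a = (a + 1) * n := by
  induction a with
  | zero => simp
  | succ a ih => rw [cartesianPowDim_succ, ih]; ring

/-- Powers of a smooth projective variety are smooth projective: `X^{×(a+1)}` has dimension
`cartesianPowDim n a = (a + 1) n` (`IsSmoothProjective.tensor_holds`, iterated).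
[cite: Hartshorne1977, III Prop. 10.1 (d) and II Ex. 4.9] -/
theorem isSmoothProjective_cartesianPow (hX : Motives.IsSmoothProjective n X) :
    ∀ a : ℕ, Motives.IsSmoothProjective (cartesianPowDim n a) (cartesianPow X (a + 1))
  | 0 => hX
  | a + 1 => Motives.IsSmoothProjective.tensor_holds (isSmoothProjective_cartesianPow hX a) hX

/-! ### Künneth families: the diagonal extension of `g ∈ ∏ₖ GL(Hᵏ(X(ℂ); ℂ))` to the powers -/

variable (X) in
/-- A family `G = (G_{a,k})`, `G_{a,k} ∈ GL(Hᵏ(X^{×(a+1)}(ℂ); ℂ))`, **is a Künneth family** (is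
the diagonal extension of its first member `g = G_0 ∈ ∏ₖ GL(Hᵏ(X(ℂ); ℂ))` to all powers): on
`X^{×(a+2)} = X^{×(a+1)} ⊗ X` it is compatible with cross products,
`G_{a+1}(pr₁^* x ∪ pr₂^* y) = pr₁^*(G_a x) ∪ pr₂^*(G_0 y)`. Since the cross products span
(Künneth, Hatcher Thm. 3.16; the tree's `kunnethSpan_complexBetti`), `G` is determined by `G_0`
(`IsKunnethFamily.ext_of_apply_zero`): `G_a` is `g^{⊗(a+1)}` transported along the Künneth
isomorphism `H^*(X(ℂ))^{⊗(a+1)} ≅ H^*(X^{×(a+1)}(ℂ))` — the action of `GL(H_B(X))` on the tensor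
powers `H_B(X)^{⊗(a+1)} = H_B(X^{a+1})` through which André's and Deligne's groups are cut out
(André 1996 §4.3–4.4: the Künneth formula is the tensor structure of the Betti realisation).
[cite: Andre1996Motifs, §4.3–4.4 (pp. 22–23) and §4.6 (ii) (p. 24)] [cite: HatcherAT2002, §3.2 Thm. 3.16] -/
structure IsKunnethFamily
    (G : ∀ a k : ℕ, complexBetti (cartesianPow X (a + 1)) k ≃ₗ[ℂ] complexBetti (cartesianPow X (a + 1)) k) :
    Prop where
  /-- Compatibility with cross products on `X^{×(a+2)} = X^{×(a+1)} ⊗ X`.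
  [cite: Andre1996Motifs, §4.3 (p. 22)] -/
  map_cross : ∀ (a i j k : ℕ) (h : i + j = k) (x : complexBetti (cartesianPow X (a + 1)) i)
    (y : complexBetti X j),
    G (a + 1) k (cupProduct h (complexBetti.map (fst (cartesianPow X (a + 1)) X) i x)
        (complexBetti.map (snd (cartesianPow X (a + 1)) X) j y)) =
      cupProduct h (complexBetti.map (fst (cartesianPow X (a + 1)) X) i (G a i x))
        (complexBetti.map (snd (cartesianPow X (a + 1)) X) j (G 0 j y))

namespace IsKunnethFamily

variable {G G' : ∀ a k : ℕ, complexBetti (cartesianPow X (a + 1)) k ≃ₗ[ℂ] complexBetti (cartesianPow X (a + 1)) k}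

/-- The identity family is a Künneth family. [folklore] -/
theorem one : IsKunnethFamily X 1 :=
  ⟨fun a i j k h x y ↦ by simp only [Pi.one_apply, LinearEquiv.coe_one, id_eq]⟩

/-- Künneth families are closed under (pointwise) composition. [folklore] -/
theorem mul (hG : IsKunnethFamily X G) (hG' : IsKunnethFamily X G') : IsKunnethFamily X (G * G') :=
  ⟨fun a i j k h x y ↦ by
    simp only [Pi.mul_apply, LinearEquiv.mul_apply]
    rw [hG'.map_cross, hG.map_cross]⟩

/-- Künneth families are closed under (pointwise) inversion. [folklore] -/
theorem inv (hG : IsKunnethFamily X G) : IsKunnethFamily X G⁻¹ :=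
  ⟨fun a i j k h x y ↦ by
    simp only [Pi.inv_apply, LinearEquiv.coe_inv]
    rw [LinearEquiv.symm_apply_eq, hG.map_cross, LinearEquiv.apply_symm_apply,
      LinearEquiv.apply_symm_apply]⟩

/-- **A Künneth family is determined by its first member** (`X` smooth projective): if `G`, `G'`
are Künneth families with `G_0 = G'_0` then `G = G'` — by induction on the power, two linear maps
agreeing on the spanning cross products `pr₁^* x ∪ pr₂^* y` (`kunnethSpan_complexBetti`) agree.
[cite: HatcherAT2002, §3.2 Thm. 3.16] -/
theorem ext_of_apply_zero (hX : Motives.IsSmoothProjective n X) (hG : IsKunnethFamily X G)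
    (hG' : IsKunnethFamily X G') (h0 : G 0 = G' 0) : G = G' := by
  funext a
  induction a with
  | zero => exact h0
  | succ a ih =>
    funext k
    refine LinearEquiv.ext fun z ↦ ?_
    have hz := kunnethSpan_complexBetti (isSmoothProjective_cartesianPow hX a) hX k z
    induction hz using Submodule.span_induction with
    | mem v hv =>
      obtain ⟨i, j, h, b, w, rfl⟩ := hv
      rw [hG.map_cross, hG'.map_cross, ih, h0]
    | zero => simp
    | add v v' _ _ hv hv' => rw [map_add, map_add, hv, hv']
    | smul c v _ hv => rw [map_smul, map_smul, hv]

end IsKunnethFamily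

/-! ### Stabilisers and similitude groups of a system of classes on the powers -/

variable (X) in
/-- **The stabiliser of a system of classes on the powers of `X`**: for
`S = (S_{a,p} ⊆ H²ᵖ(X^{×(a+1)}(ℂ); ℂ))_{a,p}`, the subgroup of `∏ₖ GL(Hᵏ(X(ℂ); ℂ))` of the `g`
admitting a Künneth family `G` with `G_0 = g` (unique, `IsKunnethFamily.ext_of_apply_zero`) which
FIXES every class of `S`: `G_a ξ = ξ` for `ξ ∈ S_{a,p}`. With `S` = motivated classes this is
`G¹_mot(X)(ℂ)` (`specialMotivatedGaloisGroup`), with `S` = rational `(p,p)`-classes it is `Hg(X)(ℂ)`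
(`hodgeGroup`); the shape "subgroup of `GL(H)` fixing given tensors" is André 1996 §4.6 (ii) /
Deligne I §3. [cite: Andre1996Motifs, §4.6 (ii) (p. 24)] [cite: Deligne1982HodgeCycles, I §3 (definition preceding Prop. 3.4) and Prop. 3.1] -/
def powClassStabilizer (S : ∀ a p : ℕ, Set (complexBetti (cartesianPow X (a + 1)) (2 * p))) :
    Subgroup (∀ k : ℕ, complexBetti X k ≃ₗ[ℂ] complexBetti X k) where
  carrier := {g | ∃ G : ∀ a k : ℕ, complexBetti (cartesianPow X (a + 1)) k ≃ₗ[ℂ] complexBetti (cartesianPow X (a + 1)) k,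
    IsKunnethFamily X G ∧ G 0 = g ∧ ∀ (a p : ℕ), ∀ x ∈ S a p, G a (2 * p) x = x}
  mul_mem' := by
    rintro g g' ⟨G, hG, rfl, hGS⟩ ⟨G', hG', rfl, hG'S⟩
    refine ⟨G * G', hG.mul hG', rfl, fun a p x hx ↦ ?_⟩
    simp only [Pi.mul_apply, LinearEquiv.mul_apply]
    rw [hG'S a p x hx, hGS a p x hx]
  one_mem' := ⟨1, IsKunnethFamily.one, rfl, fun a p x _ ↦ by simp⟩
  inv_mem' := by
    rintro g ⟨G, hG, rfl, hGS⟩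
    refine ⟨G⁻¹, hG.inv, rfl, fun a p x hx ↦ ?_⟩
    simp only [Pi.inv_apply, LinearEquiv.coe_inv]
    rw [LinearEquiv.symm_apply_eq]
    exact (hGS a p x hx).symm

variable (X) in
/-- **The similitude group of a system of classes on the powers of `X`**: as `powClassStabilizer`,
but the Künneth family is only required to act on the classes of `S` THROUGH A CHARACTER OF TATE
TYPE — there is `c ∈ ℂˣ` with `G_a ξ = cᵖ • ξ` for all `a`, `p` and `ξ ∈ S_{a,p} ⊆ H²ᵖ`. This is how
André's full group `G_mot(X) ⊇ w(𝔾_m)` acts on motivated classes (`ξ ∈ A_motᵖ ⊆ H²ᵖ(p)` is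
multiplied by `χ(g)⁻ᵖ`, `χ` the character of `G_mot` on `H_B(𝟙(1))`; §4.1: "on regarde les cycles
motivés de `A_mot(X)` comme des éléments de `H²ᵖ(X)(p)`"), and how Deligne's `MT ≤ GL(V) × 𝔾_m`
acts on Hodge classes (I §3). With `S` = motivated classes this is `G_mot(X)(ℂ)`
(`motivatedGaloisGroup`), with `S` = rational `(p,p)`-classes `MT(X)(ℂ)` (`mumfordTateGroup`).
[cite: Andre1996Motifs, §4.1 (p. 22) and §4.6 Définition, (ii) (p. 24)] [cite: Deligne1982HodgeCycles, I §3 (definition preceding Prop. 3.4)] -/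
def powClassSimilitudeGroup (S : ∀ a p : ℕ, Set (complexBetti (cartesianPow X (a + 1)) (2 * p))) :
    Subgroup (∀ k : ℕ, complexBetti X k ≃ₗ[ℂ] complexBetti X k) where
  carrier := {g | ∃ G : ∀ a k : ℕ, complexBetti (cartesianPow X (a + 1)) k ≃ₗ[ℂ] complexBetti (cartesianPow X (a + 1)) k,
    IsKunnethFamily X G ∧ G 0 = g ∧
      ∃ c : ℂˣ, ∀ (a p : ℕ), ∀ x ∈ S a p, G a (2 * p) x = ((c : ℂ) ^ p) • x}
  mul_mem' := by
    rintro g g' ⟨G, hG, rfl, c, hGS⟩ ⟨G', hG', rfl, c', hG'S⟩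
    refine ⟨G * G', hG.mul hG', rfl, c * c', fun a p x hx ↦ ?_⟩
    simp only [Pi.mul_apply, LinearEquiv.mul_apply]
    rw [hG'S a p x hx, map_smul, hGS a p x hx, smul_smul, Units.val_mul, mul_pow, mul_comm ((c' : ℂ) ^ p)]
  one_mem' := ⟨1, IsKunnethFamily.one, rfl, 1, fun a p x _ ↦ by simp⟩
  inv_mem' := by
    rintro g ⟨G, hG, rfl, c, hGS⟩
    refine ⟨G⁻¹, hG.inv, rfl, c⁻¹, fun a p x hx ↦ ?_⟩
    simp only [Pi.inv_apply, LinearEquiv.coe_inv]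
    rw [LinearEquiv.symm_apply_eq, map_smul, hGS a p x hx, smul_smul, Units.val_inv_eq_inv_val,
      inv_pow, inv_mul_cancel₀ (pow_ne_zero _ c.ne_zero), one_smul]

section Generic

variable {S T : ∀ a p : ℕ, Set (complexBetti (cartesianPow X (a + 1)) (2 * p))}
  {g : ∀ k : ℕ, complexBetti X k ≃ₗ[ℂ] complexBetti X k}

/-- Membership in the stabiliser, unfolded. [folklore] -/
theorem mem_powClassStabilizer_iff :
    g ∈ powClassStabilizer X S ↔
      ∃ G : ∀ a k : ℕ, complexBetti (cartesianPow X (a + 1)) k ≃ₗ[ℂ] complexBetti (cartesianPow X (a + 1)) k,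
        IsKunnethFamily X G ∧ G 0 = g ∧ ∀ (a p : ℕ), ∀ x ∈ S a p, G a (2 * p) x = x :=
  Iff.rfl

/-- Membership in the similitude group, unfolded. [folklore] -/
theorem mem_powClassSimilitudeGroup_iff :
    g ∈ powClassSimilitudeGroup X S ↔
      ∃ G : ∀ a k : ℕ, complexBetti (cartesianPow X (a + 1)) k ≃ₗ[ℂ] complexBetti (cartesianPow X (a + 1)) k,
        IsKunnethFamily X G ∧ G 0 = g ∧
          ∃ c : ℂˣ, ∀ (a p : ℕ), ∀ x ∈ S a p, G a (2 * p) x = ((c : ℂ) ^ p) • x :=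
  Iff.rfl

/-- An element of the stabiliser fixes the classes of `X` itself (the `a = 0` member of its
Künneth family is `g`). [folklore] -/
theorem apply_eq_self_of_mem_powClassStabilizer (hg : g ∈ powClassStabilizer X S) {p : ℕ}
    {x : complexBetti X (2 * p)} (hx : x ∈ S 0 p) : g (2 * p) x = x := by
  obtain ⟨G, -, rfl, hGS⟩ := hg
  exact hGS 0 p x hx

/-- An element of the similitude group acts on the classes of `X` itself through a character of
Tate type. [folklore] -/
theorem exists_apply_eq_smul_of_mem_powClassSimilitudeGroup (hg : g ∈ powClassSimilitudeGroup X S) :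
    ∃ c : ℂˣ, ∀ (p : ℕ), ∀ x ∈ S 0 p, g (2 * p) x = ((c : ℂ) ^ p) • x := by
  obtain ⟨G, -, rfl, c, hGS⟩ := hg
  exact ⟨c, hGS 0⟩

/-- The stabiliser is contained in the similitude group (`c = 1`). [folklore] -/
theorem powClassStabilizer_le_powClassSimilitudeGroup :
    powClassStabilizer X S ≤ powClassSimilitudeGroup X S := by
  rintro g ⟨G, hG, rfl, hGS⟩
  exact ⟨G, hG, rfl, 1, fun a p x hx ↦ by rw [hGS a p x hx, Units.val_one, one_pow, one_smul]⟩

/-- Stabilisers are antitone in the system of classes. [folklore] -/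
theorem powClassStabilizer_anti (h : ∀ a p, S a p ⊆ T a p) :
    powClassStabilizer X T ≤ powClassStabilizer X S := by
  rintro g ⟨G, hG, rfl, hGS⟩
  exact ⟨G, hG, rfl, fun a p x hx ↦ hGS a p x (h a p hx)⟩

/-- Similitude groups are antitone in the system of classes. [folklore] -/
theorem powClassSimilitudeGroup_anti (h : ∀ a p, S a p ⊆ T a p) :
    powClassSimilitudeGroup X T ≤ powClassSimilitudeGroup X S := by
  rintro g ⟨G, hG, rfl, c, hGS⟩
  exact ⟨G, hG, rfl, c, fun a p x hx ↦ hGS a p x (h a p hx)⟩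

/-- Fixing a set of classes or its `ℂ`-span is the same condition. [folklore] -/
theorem powClassStabilizer_span :
    powClassStabilizer X (fun a p ↦ (Submodule.span ℂ (S a p) : Set _)) = powClassStabilizer X S := by
  refine le_antisymm (powClassStabilizer_anti fun a p ↦ Submodule.subset_span) ?_
  rintro g ⟨G, hG, rfl, hGS⟩
  refine ⟨G, hG, rfl, fun a p x hx ↦ ?_⟩
  have h := LinearMap.eqOn_span' (f := (G a (2 * p) : _ →ₗ[ℂ] _)) (g := LinearMap.id)
    (fun y hy ↦ hGS a p y hy) hx
  simpa using h

/-- Acting through a character on a set of classes or on its `ℂ`-span is the same condition.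
[folklore] -/
theorem powClassSimilitudeGroup_span :
    powClassSimilitudeGroup X (fun a p ↦ (Submodule.span ℂ (S a p) : Set _)) =
      powClassSimilitudeGroup X S := by
  refine le_antisymm (powClassSimilitudeGroup_anti fun a p ↦ Submodule.subset_span) ?_
  rintro g ⟨G, hG, rfl, c, hGS⟩
  refine ⟨G, hG, rfl, c, fun a p x hx ↦ ?_⟩
  have h := LinearMap.eqOn_span' (f := (G a (2 * p) : _ →ₗ[ℂ] _))
    (g := ((c : ℂ) ^ p) • LinearMap.id) (fun y hy ↦ by simpa using hGS a p y hy) hx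
  simpa using h

/-! ### The weight cocharacter and the decomposition `Sim = w(ℂˣ) · Stab` -/

variable (X) in
/-- **The weight cocharacter** `w : ℂˣ → ∏ₖ GL(Hᵏ(X(ℂ); ℂ))`, `w(λ) = λᵏ` on `Hᵏ` (André 1996
§4.6: "un homomorphisme central `w : 𝔾_m → G_𝒱` (du fait que `𝓜(𝒱)` est graduée)"; Deligne's
`μ ∘ (weight)`), on the real carriers. [cite: Andre1996Motifs, §4.6 Définition (p. 24)] -/
def weightCocharacter (c : ℂˣ) : ∀ k : ℕ, complexBetti X k ≃ₗ[ℂ] complexBetti X k :=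
  fun k ↦ LinearEquiv.smulOfUnit (c ^ k)

/-- `w(λ)` acts on `Hᵏ(X(ℂ); ℂ)` by `λᵏ`. [folklore] -/
@[simp] theorem weightCocharacter_apply (c : ℂˣ) (k : ℕ) (x : complexBetti X k) :
    weightCocharacter X c k x = ((c : ℂ) ^ k) • x := by
  simp [weightCocharacter, LinearEquiv.smulOfUnit, Units.smul_def]

variable (X) in
/-- `w` is a group homomorphism `ℂˣ → ∏ₖ GL(Hᵏ(X(ℂ); ℂ))`. [folklore] -/
theorem weightCocharacter_mul (c c' : ℂˣ) :
    weightCocharacter X (c * c') = weightCocharacter X c * weightCocharacter X c' := by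
  funext k
  refine LinearEquiv.ext fun x ↦ ?_
  simp only [weightCocharacter_apply, Pi.mul_apply, LinearEquiv.mul_apply, smul_smul, Units.val_mul,
    mul_pow]

variable (X) in
/-- `w(1) = 1`. [folklore] -/
@[simp] theorem weightCocharacter_one : weightCocharacter X 1 = 1 := by
  funext k
  refine LinearEquiv.ext fun x ↦ ?_
  simp

variable (X) in
/-- `w(λ⁻¹) = w(λ)⁻¹`. [folklore] -/
theorem weightCocharacter_inv (c : ℂˣ) : weightCocharacter X c⁻¹ = (weightCocharacter X c)⁻¹ :=
  eq_inv_of_mul_eq_one_left (by rw [← weightCocharacter_mul, inv_mul_cancel, weightCocharacter_one])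

variable (X) in
/-- The Künneth family of `w(λ)`: `λᵏ` on `Hᵏ` of every power. [folklore] -/
def weightCocharacterFamily (c : ℂˣ) :
    ∀ a k : ℕ, complexBetti (cartesianPow X (a + 1)) k ≃ₗ[ℂ] complexBetti (cartesianPow X (a + 1)) k :=
  fun _ k ↦ LinearEquiv.smulOfUnit (c ^ k)

/-- `w(λ)` on the powers acts on `Hᵏ` by `λᵏ`. [folklore] -/
@[simp] theorem weightCocharacterFamily_apply (c : ℂˣ) (a k : ℕ) (x : complexBetti (cartesianPow X (a + 1)) k) :
    weightCocharacterFamily X c a k x = ((c : ℂ) ^ k) • x := by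
  simp [weightCocharacterFamily, LinearEquiv.smulOfUnit, Units.smul_def]

/-- The family `(λᵏ on Hᵏ(X^{×(a+1)}))` is a Künneth family extending `w(λ)`: degrees add under
cross products. [folklore] -/
theorem isKunnethFamily_weightCocharacterFamily (c : ℂˣ) :
    IsKunnethFamily X (weightCocharacterFamily X c) :=
  ⟨fun a i j k h x y ↦ by
    simp only [weightCocharacterFamily_apply]
    change ((c : ℂ) ^ k) • cupProduct h (complexBetti.map (fst (cartesianPow X (a + 1)) X) i x)
        (complexBetti.map (snd (cartesianPow X (a + 1)) X) j y) =
      cupProduct h (complexBetti.map (fst (cartesianPow X (a + 1)) X) i (((c : ℂ) ^ i) • x))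
        (complexBetti.map (snd (cartesianPow X (a + 1)) X) j (((c : ℂ) ^ j) • y))
    rw [map_smul, map_smul, map_smul, map_smul, LinearMap.smul_apply, smul_smul, ← pow_add]
    congr 2
    omega⟩

/-- The first member of the family of `w(λ)` is `w(λ)`. [folklore] -/
@[simp] theorem weightCocharacterFamily_zero (c : ℂˣ) : weightCocharacterFamily X c 0 = weightCocharacter X c :=
  rfl

/-- **The weight cocharacter lies in every similitude group** (with character `c = λ²`: `w(λ)`
multiplies `H²ᵖ` by `λ²ᵖ = (λ²)ᵖ`) — in particular in `G_mot(X)(ℂ)` and `MT(X)(ℂ)`, whatever the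
classes (André 1996 §4.6: `w(𝔾_m) ≤ G_𝒱` is central; Deligne I 3.4). [cite: Andre1996Motifs, §4.6 Définition (p. 24)] -/
theorem weightCocharacter_mem_powClassSimilitudeGroup (c : ℂˣ) :
    weightCocharacter X c ∈ powClassSimilitudeGroup X S :=
  ⟨weightCocharacterFamily X c, isKunnethFamily_weightCocharacterFamily c, rfl, c ^ 2,
    fun a p x _ ↦ by rw [weightCocharacterFamily_apply, Units.val_pow_eq_pow_val, ← pow_mul]⟩

/-- **`Sim(S) = w(ℂˣ) · Stab(S)`**: `g` acts on the classes of `S` through a character iff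
`g = w(λ) · g'` with `g'` FIXING the classes of `S` — because `ℂ` has square roots: for the
character `c` of `g` take `μ² = c⁻¹`; then `w(μ) g` fixes `S` and `g = w(μ⁻¹) (w(μ) g)`. For the
motivated classes this is `G_mot(ℂ) = w(ℂˣ) · G¹_mot(ℂ)`, for the Hodge classes
`MT(ℂ) = w(ℂˣ) · Hg(ℂ)` (Deligne I Prop. 3.4 with `G⁰ = Ker(G → 𝔾_m)`: `MT = 𝔾_m · Hg` in non-zero
weight). [cite: Deligne1982HodgeCycles, I Prop. 3.4] -/
theorem mem_powClassSimilitudeGroup_iff_exists_weightCocharacter_mul :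
    g ∈ powClassSimilitudeGroup X S ↔
      ∃ (c : ℂˣ) (g' : ∀ k : ℕ, complexBetti X k ≃ₗ[ℂ] complexBetti X k),
        g' ∈ powClassStabilizer X S ∧ g = weightCocharacter X c * g' := by
  constructor
  · rintro ⟨G, hG, rfl, c, hGS⟩
    -- a square root `μ` of `c⁻¹`
    obtain ⟨μ₀, hμ₀⟩ := IsAlgClosed.exists_pow_nat_eq ((c⁻¹ : ℂˣ) : ℂ) two_pos
    have hμ₀0 : μ₀ ≠ 0 := by
      rintro rfl
      rw [zero_pow two_ne_zero] at hμ₀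
      exact (c⁻¹).ne_zero hμ₀.symm
    set μ : ℂˣ := Units.mk0 μ₀ hμ₀0 with hμ
    have hμc : ((μ : ℂ) ^ 2) * c = 1 := by
      rw [hμ, Units.val_mk0, hμ₀, Units.inv_mul]
    refine ⟨μ⁻¹, (weightCocharacterFamily X μ * G) 0, ⟨weightCocharacterFamily X μ * G,
      (isKunnethFamily_weightCocharacterFamily μ).mul hG, rfl, fun a p x hx ↦ ?_⟩, ?_⟩
    · simp only [Pi.mul_apply, LinearEquiv.mul_apply]
      rw [hGS a p x hx, map_smul, weightCocharacterFamily_apply, smul_smul, pow_mul, ← mul_pow,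
        mul_comm (c : ℂ) ((μ : ℂ) ^ 2), hμc, one_pow, one_smul]
    · -- `G 0 = w(μ⁻¹) (w(μ) G 0)`: on `Hᵏ`, `μ⁻ᵏ μᵏ = 1`
      funext k
      refine LinearEquiv.ext fun x ↦ ?_
      change G 0 k x = (((μ⁻¹ : ℂˣ) : ℂ) ^ k) • ((((μ : ℂˣ) : ℂ) ^ k) • G 0 k x)
      rw [smul_smul, ← mul_pow, Units.val_inv_eq_inv_val, inv_mul_cancel₀ μ.ne_zero, one_pow, one_smul]
  · rintro ⟨c, g', hg', rfl⟩
    exact mul_mem (weightCocharacter_mem_powClassSimilitudeGroup c)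
      (powClassStabilizer_le_powClassSimilitudeGroup hg')

/-- Consequently two systems of classes with the same stabiliser have the same similitude group.
[folklore] -/
theorem powClassSimilitudeGroup_eq_of_powClassStabilizer_eq
    (h : powClassStabilizer X S = powClassStabilizer X T) :
    powClassSimilitudeGroup X S = powClassSimilitudeGroup X T := by
  ext g
  rw [mem_powClassSimilitudeGroup_iff_exists_weightCocharacter_mul,
    mem_powClassSimilitudeGroup_iff_exists_weightCocharacter_mul, h]

end Generic

/-! ### The motivated Galois group and the Mumford–Tate group of `X` -/

variable (n X) in
/-- The system of **motivated classes on the powers** of the `n`-dimensional `X`: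
`(a, p) ↦ A_motᵖ(X^{×(a+1)})_ℂ = motivatedClasses ((a+1) n) X^{×(a+1)} p ⊆ H²ᵖ(X^{×(a+1)}(ℂ); ℂ)`
(André 1996 Déf. 1 on the real carriers; at `a = 0` this is `motivatedClasses n X p` on the nose).
[cite: Andre1996Motifs, §2.1 Déf. 1 (p. 14)] -/
def motivatedPowClasses : ∀ a p : ℕ, Set (complexBetti (cartesianPow X (a + 1)) (2 * p)) :=
  fun a p ↦ motivatedClasses (cartesianPowDim n a) (cartesianPow X (a + 1)) p

variable (n X) in
/-- The system of **rational Hodge classes on the powers** of the `n`-dimensional `X`: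
`(a, p) ↦ {c ∈ H²ᵖ(X^{×(a+1)}(ℂ); ℂ) | c rational and of Hodge type (p,p)}` (`IsRationalClass`,
`IsOfHodgeType`; at `a = 0` the rational `(p,p)`-classes of `X` on the nose).
[cite: Deligne1982HodgeCycles, I §3 (definition preceding Prop. 3.4)] -/
def hodgePowClasses : ∀ a p : ℕ, Set (complexBetti (cartesianPow X (a + 1)) (2 * p)) :=
  fun a p ↦ {c | IsRationalClass c ∧ IsOfHodgeType (cartesianPowDim n a) (cartesianPow X (a + 1)) (2 * p) p p c}

/-- At `a = 0` the motivated system is `motivatedClasses n X p`. [folklore] -/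
@[simp] theorem motivatedPowClasses_zero (p : ℕ) :
    motivatedPowClasses n X 0 p = (motivatedClasses n X p : Set (complexBetti X (2 * p))) := rfl

/-- At `a = 0` the Hodge system is the set of rational `(p,p)`-classes of `X`. [folklore] -/
@[simp] theorem mem_hodgePowClasses_zero_iff (p : ℕ) (c : complexBetti X (2 * p)) :
    c ∈ hodgePowClasses n X 0 p ↔ IsRationalClass c ∧ IsOfHodgeType n X (2 * p) p p c := Iff.rfl

variable (n X) in
/-- **André's motivated Galois group `G_mot(X)(ℂ)` on the real carriers, Tannaka-free** (André 1996,
Thm. 0.4 and §4.6 Définition: `G(h(X))`, the image of `G_𝒱 = Aut^⊗(H_B | 𝓜(𝒱))` in `GL(H_B(X))`,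
`𝒱` = all smooth projective complex varieties; (ii): "le sous-groupe algébrique de `GL(H_B(M))` qui
fixe les cycles motivés parmi les tenseurs mixtes sur `H_B(M)`"): the subgroup of
`∏ₖ GL(Hᵏ(X(ℂ); ℂ))` of the `g` whose Künneth (diagonal) extension to the powers `X^{×(a+1)}` acts
on every motivated class `ξ ∈ A_motᵖ(X^{×(a+1)})_ℂ` by `cᵖ` for one `c = χ(g)⁻¹ ∈ ℂˣ` (`χ` the Tate
character: motivated classes live in `H²ᵖ(p)`, §4.1). Its `ℂ`-points-of-`G(h(X))` identification
(via (i), (ii), Chevalley–Deligne I 3.1 (c) and Poincaré duality) is in the module docstring; it is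
REDUCTIVE by (i) and contains the Mumford–Tate group (§6.2 p. 31;
`mumfordTateGroup_le_motivatedGaloisGroup`); its connectedness is not known (Remarque (ii) p. 25).
`G_mot = w(ℂˣ) · G¹_mot` (`mem_powClassSimilitudeGroup_iff_exists_weightCocharacter_mul`).
[cite: Andre1996Motifs, Thm. 0.4 (p. 8), §4.1 (p. 22), §4.6 Définition and (i)–(ii) (p. 24)] -/
def motivatedGaloisGroup : Subgroup (∀ k : ℕ, complexBetti X k ≃ₗ[ℂ] complexBetti X k) :=
  powClassSimilitudeGroup X (motivatedPowClasses n X)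

variable (n X) in
/-- **The special motivated Galois group `G¹_mot(X)(ℂ) = ker(χ : G_mot(X) → 𝔾_m)(ℂ)`** (notation
ours; the analogue inside `G_mot` of the Hodge group inside the Mumford–Tate group): the subgroup of
`∏ₖ GL(Hᵏ(X(ℂ); ℂ))` of the `g` whose Künneth extension to the powers FIXES every motivated class of
every power `X^{×(a+1)}` — the common stabiliser of all motivated classes on all powers (André 1996
§4.6 (ii) with the Tate twists of §4.1 undone). [cite: Andre1996Motifs, §4.6 (ii) (p. 24) and §4.1 (p. 22)] -/
def specialMotivatedGaloisGroup : Subgroup (∀ k : ℕ, complexBetti X k ≃ₗ[ℂ] complexBetti X k) :=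
  powClassStabilizer X (motivatedPowClasses n X)

variable (n X) in
/-- **The Mumford–Tate group `MT(X)(ℂ)` of `H^*(X(ℂ); ℚ)` on the real carriers, Tannaka-free**
(Deligne, LNM 900, I §3: the subgroup of `GL(V) × 𝔾_m` fixing the rational tensors of type `(0,0)`,
Prop. 3.4; projected to `GL(V)` and on `ℂ`-points): the subgroup of `∏ₖ GL(Hᵏ(X(ℂ); ℂ))` of the `g`
whose Künneth extension acts on every rational class of Hodge type `(p,p)` of every power
`X^{×(a+1)}` by `cᵖ` for one `c ∈ ℂˣ`. Identification with `MT(⊕ₖ Hᵏ(X(ℂ); ℚ))(ℂ)` acting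
diagonally (Deligne I 3.1 (c), 3.4, 3.6) in the module docstring; `MT = w(ℂˣ) · Hg`. The tree's
`Motives.HodgeStructure.mumfordTateGroup` is the same notion for ONE abstract pure `ℚ`-Hodge
structure (`ℚ`-points). [cite: Deligne1982HodgeCycles, I §3 (definition preceding Prop. 3.4) and Prop. 3.4] -/
def mumfordTateGroup : Subgroup (∀ k : ℕ, complexBetti X k ≃ₗ[ℂ] complexBetti X k) :=
  powClassSimilitudeGroup X (hodgePowClasses n X)

variable (n X) in
/-- **The Hodge group (special Mumford–Tate group) `Hg(X)(ℂ)` on the real carriers, Tannaka-free**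
(Deligne I §3, before Thm. 3.8: `G⁰ = Ker(G → 𝔾_m)`; Moonen §4–5: the subgroup fixing all Hodge classes of all
types `(p,p)` in the tensor spaces): the subgroup of `∏ₖ GL(Hᵏ(X(ℂ); ℂ))` of the `g` whose Künneth
extension FIXES every rational `(p,p)`-class of every power `X^{×(a+1)}`. The tree's
`Motives.HodgeStructure.hodgeGroup` is the same notion for one abstract pure `ℚ`-Hodge structure.
[cite: Deligne1982HodgeCycles, I §3 (special Mumford–Tate group, before Thm. 3.8)] [cite: Moonen2004MT, §4 and §5] -/
def hodgeGroup : Subgroup (∀ k : ℕ, complexBetti X k ≃ₗ[ℂ] complexBetti X k) :=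
  powClassStabilizer X (hodgePowClasses n X)

/-- `G¹_mot(X) ≤ G_mot(X)`. [folklore] -/
theorem specialMotivatedGaloisGroup_le_motivatedGaloisGroup :
    specialMotivatedGaloisGroup n X ≤ motivatedGaloisGroup n X :=
  powClassStabilizer_le_powClassSimilitudeGroup

/-- `Hg(X) ≤ MT(X)` (Deligne I 3.4–3.5; Moonen §4). [cite: Deligne1982HodgeCycles, I Prop. 3.4] -/
theorem hodgeGroup_le_mumfordTateGroup : hodgeGroup n X ≤ mumfordTateGroup n X :=
  powClassStabilizer_le_powClassSimilitudeGroup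

/-- `w(ℂˣ) ≤ G_mot(X)` (André §4.6: the central weight cocharacter). [cite: Andre1996Motifs, §4.6 Définition (p. 24)] -/
theorem weightCocharacter_mem_motivatedGaloisGroup (c : ℂˣ) :
    weightCocharacter X c ∈ motivatedGaloisGroup n X :=
  weightCocharacter_mem_powClassSimilitudeGroup c

/-- `w(ℂˣ) ≤ MT(X)` (Deligne I 3.4: `MT` is generated by the conjugates of `μ(𝔾_m)`; the weight
cocharacter is `μ` composed with the diagonal). [cite: Deligne1982HodgeCycles, I Prop. 3.4] -/
theorem weightCocharacter_mem_mumfordTateGroup (c : ℂˣ) :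
    weightCocharacter X c ∈ mumfordTateGroup n X :=
  weightCocharacter_mem_powClassSimilitudeGroup c

/-- **Motivated classes are fixed by `G¹_mot(X)`** (the definitional half of André §4.6 (ii) in the
`G¹`-form): for `g ∈ G¹_mot(X)(ℂ)` and `x ∈ A_motᵖ(X)_ℂ`, `g x = x`. [cite: Andre1996Motifs, §4.6 (ii) (p. 24)] -/
theorem apply_eq_self_of_mem_specialMotivatedGaloisGroup {g : ∀ k : ℕ, complexBetti X k ≃ₗ[ℂ] complexBetti X k}
    (hg : g ∈ specialMotivatedGaloisGroup n X) {p : ℕ} {x : complexBetti X (2 * p)}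
    (hx : x ∈ motivatedClasses n X p) : g (2 * p) x = x :=
  apply_eq_self_of_mem_powClassStabilizer hg hx

/-- **`G_mot(X)` acts on the motivated classes of `X` through a character of Tate type**: for
`g ∈ G_mot(X)(ℂ)` there is `c ∈ ℂˣ` with `g x = cᵖ x` for all `x ∈ A_motᵖ(X)_ℂ` and all `p`
(André §4.1/§4.6). [cite: Andre1996Motifs, §4.1 (p. 22) and §4.6 (ii) (p. 24)] -/
theorem exists_apply_eq_smul_of_mem_motivatedGaloisGroup {g : ∀ k : ℕ, complexBetti X k ≃ₗ[ℂ] complexBetti X k}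
    (hg : g ∈ motivatedGaloisGroup n X) :
    ∃ c : ℂˣ, ∀ (p : ℕ), ∀ x ∈ motivatedClasses n X p, g (2 * p) x = ((c : ℂ) ^ p) • x :=
  exists_apply_eq_smul_of_mem_powClassSimilitudeGroup hg

/-- **Rational `(p,p)`-classes are fixed by `Hg(X)`** (definitional). [cite: Deligne1982HodgeCycles, I §3 (special Mumford–Tate group, before Thm. 3.8)] -/
theorem apply_eq_self_of_mem_hodgeGroup {g : ∀ k : ℕ, complexBetti X k ≃ₗ[ℂ] complexBetti X k}
    (hg : g ∈ hodgeGroup n X) {p : ℕ} {c : complexBetti X (2 * p)} (hc : IsRationalClass c)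
    (hpp : IsOfHodgeType n X (2 * p) p p c) : g (2 * p) c = c :=
  apply_eq_self_of_mem_powClassStabilizer hg (p := p) (show c ∈ hodgePowClasses n X 0 p from ⟨hc, hpp⟩)

/-! ### Named facts (André 1996 §2.5 c) and §4.6 (ii)) and the comparison `MT ≤ G_mot` -/

/-- **Motivated classes are Hodge classes** (André 1996, §2.5 c), p. 18: "Pour `F = ℂ`, ces espaces
sont bigradués (Hodge). Tout élément de `A_mot(X) ⊆ H^{2j}(X ⊗_σ ℂ, ℚ)(j)` est de type `(0,0)`
(`ℚ(j)` est de type `(-j,-j)`)" — combined in Prop. 2.5.1 into "absolute Hodge"; with Prop. 3.2.1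
(p. 20, "la surjection canonique `A_mot(X)_Q ⊗_Q E → A_mot(X)_E` est bijective") and Prop. 3.3
(p. 21, `Q = ℚ` for Betti cohomology): `A_mot(X)_ℂ = A_mot(X)_ℚ ⊗ ℂ`), on the real carriers: for `X`
smooth projective of dimension `n` and every `p`, `A_motᵖ(X)_ℂ = motivatedClasses n X p` is
contained in the `ℂ`-span of the rational classes of Hodge type `(p,p)` in `H²ᵖ(X(ℂ); ℂ)`. (The
layer's generators allow `ℂ`-orientations and `ℂ`-algebraic inputs, which rescale André's
generators by complex constants and take `ℂ`-combinations — `HodgeTheory/MotivatedClasses`,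
"Faithfulness of the span" — so the `ℂ`-SPAN is the faithful target.) The tree's
`Andre1996_isAbsoluteHodgeClass_of_mem_motivatedClasses` (same directory) is the finer Prop. 2.5.1
for RATIONAL motivated classes. [cite: Andre1996Motifs, §2.5 c) and Prop. 2.5.1 (p. 18), Prop. 3.2.1 (p. 20), Prop. 3.3 (p. 21)] -/
def Andre1996_motivatedClasses_le_span_hodgeClasses : Prop :=
  ∀ ⦃n : ℕ⦄ ⦃X : Motives.SchemeOver ℂ⦄, Motives.IsSmoothProjective n X → ∀ p : ℕ,
    motivatedClasses n X p ≤
      Submodule.span ℂ {c : complexBetti X (2 * p) | IsRationalClass c ∧ IsOfHodgeType n X (2 * p) p p c}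

/-- **The invariants of `G¹_mot(X)` in `H²ᵖ(X)` are motivated** (André 1996, §4.6 (ii), p. 24:
"réciproquement, tout tenseur mixte sur `H_B(M)` fixé par `G(M)` est motivé", for `M = h(X)` and
the tensor space `H²ᵖ(X)(p)`; in the `G¹`-form of this file — see the module docstring,
"Identification" (a), (e): André's `G¹(ℂ)` is contained in `specialMotivatedGaloisGroup n X`, and a
class of `H²ᵖ(X) ⊗ ℂ` fixed by `G¹(ℂ)` is a `G`-fixed element of `H²ᵖ(X)(p) ⊗ ℂ` because
`w(𝔾_m) ≤ G` acts on `H²ᵖ` by `λ²ᵖ`), on the real carriers: for `X` smooth projective of dimension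
`n`, every `x ∈ H²ᵖ(X(ℂ); ℂ)` fixed by every `g ∈ G¹_mot(X)(ℂ)` lies in
`A_motᵖ(X)_ℂ = motivatedClasses n X p`. (The converse inclusion is
`apply_eq_self_of_mem_specialMotivatedGaloisGroup`, definitional.) Rests on Thm. 0.4 (Tannakian
reconstruction: `𝓜(𝒱) ≃ Rep G_𝒱`), whence cite-grade. [cite: Andre1996Motifs, §4.6 (ii) (p. 24) with Thm. 0.4 (p. 8) and §4.1 (p. 22)] -/
def Andre1996_specialMotivatedGaloisGroup_invariants_le : Prop :=
  ∀ ⦃n : ℕ⦄ ⦃X : Motives.SchemeOver ℂ⦄, Motives.IsSmoothProjective n X → ∀ (p : ℕ)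
    (x : complexBetti X (2 * p)),
    (∀ g ∈ specialMotivatedGaloisGroup n X, g (2 * p) x = x) → x ∈ motivatedClasses n X p

/-- Under "motivated classes are Hodge classes" (hypothesis `h`, the named fact
`Andre1996_motivatedClasses_le_span_hodgeClasses`, applied to every power `X^{×(a+1)}`, smooth
projective by `isSmoothProjective_cartesianPow`), the motivated system lies in the span of the Hodge
system, power by power. [cite: Andre1996Motifs, §2.5 c) (p. 18)] -/
theorem motivatedPowClasses_subset_span_hodgePowClasses (h : Andre1996_motivatedClasses_le_span_hodgeClasses)
    (hX : Motives.IsSmoothProjective n X) (a p : ℕ) :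
    motivatedPowClasses n X a p ⊆ (Submodule.span ℂ (hodgePowClasses n X a p) : Set _) :=
  fun _ hx ↦ h (isSmoothProjective_cartesianPow hX a) p hx

/-- **`Hg(X) ≤ G¹_mot(X)`**: fixing all rational `(p,p)`-classes on all powers fixes their
`ℂ`-spans, hence (hypothesis `h` = `Andre1996_motivatedClasses_le_span_hodgeClasses`, André §2.5 c))
all motivated classes on all powers. [cite: Andre1996Motifs, §2.5 c) (p. 18) and §6.2 (p. 31)] -/
theorem hodgeGroup_le_specialMotivatedGaloisGroup (h : Andre1996_motivatedClasses_le_span_hodgeClasses)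
    (hX : Motives.IsSmoothProjective n X) : hodgeGroup n X ≤ specialMotivatedGaloisGroup n X := by
  rw [hodgeGroup, ← powClassStabilizer_span]
  exact powClassStabilizer_anti (motivatedPowClasses_subset_span_hodgePowClasses h hX)

/-- **`MT(X) ≤ G_mot(X)`** (André 1996 §6.2, p. 31: "Pour `K ⊆ ℂ` et `H = H_B`, `G_H(A)` contient
le groupe de Mumford–Tate" — because motivated classes are Hodge classes, hypothesis `h` =
`Andre1996_motivatedClasses_le_span_hodgeClasses`, §2.5 c)), on the real carriers.
[cite: Andre1996Motifs, §6.2 (p. 31) and §2.5 c) (p. 18)] -/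
theorem mumfordTateGroup_le_motivatedGaloisGroup (h : Andre1996_motivatedClasses_le_span_hodgeClasses)
    (hX : Motives.IsSmoothProjective n X) : mumfordTateGroup n X ≤ motivatedGaloisGroup n X := by
  rw [mumfordTateGroup, ← powClassSimilitudeGroup_span]
  exact powClassSimilitudeGroup_anti (motivatedPowClasses_subset_span_hodgePowClasses h hX)

/-! ### "Hodge ⇒ motivated" as `Hg = G¹_mot` (equivalently `MT = G_mot`) -/

/-- **"Hodge classes are motivated on all powers of `X`" ⇒ `Hg(X) = G¹_mot(X)`** (André §6.3,
p. 31, for an abelian variety `A`: "tout élément `ξ` de type `(0,0)` dans `H²ᵖ_B(A, ℚ)(p)` est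
motivé. En remplaçant `A` par ses puissances, on en déduit que `G_mot(A)` coïncide avec `G_MT(A)`" —
the second sentence is the argument for any `X`): if (hypothesis `hHM`) for every `a`, `p` every
rational class of Hodge type `(p,p)` in `H²ᵖ(X^{×(a+1)}(ℂ); ℂ)` lies in `A_motᵖ(X^{×(a+1)})_ℂ` — the
instance on the powers of one `X` of the route's crux `HodgeClassesMotivated`, a THEOREM for
abelian varieties (loc. cit.) and a hypothesis here — then both groups are the stabiliser of the
same spans (hypothesis `h` = `Andre1996_motivatedClasses_le_span_hodgeClasses` gives `≤`).
[cite: Andre1996Motifs, §6.3 (p. 31)] -/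
theorem hodgeGroup_eq_specialMotivatedGaloisGroup_of_forall_mem_motivatedClasses
    (h : Andre1996_motivatedClasses_le_span_hodgeClasses) (hX : Motives.IsSmoothProjective n X)
    (hHM : ∀ (a p : ℕ) (c : complexBetti (cartesianPow X (a + 1)) (2 * p)), c ∈ hodgePowClasses n X a p →
      c ∈ motivatedClasses (cartesianPowDim n a) (cartesianPow X (a + 1)) p) :
    hodgeGroup n X = specialMotivatedGaloisGroup n X :=
  le_antisymm (hodgeGroup_le_specialMotivatedGaloisGroup h hX)
    (powClassStabilizer_anti fun a p c hc ↦ hHM a p c hc)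

/-- **… and then `MT(X) = G_mot(X)`** (`w(ℂˣ) ·` both sides). [cite: Andre1996Motifs, §6.3 (p. 31)] -/
theorem mumfordTateGroup_eq_motivatedGaloisGroup_of_forall_mem_motivatedClasses
    (h : Andre1996_motivatedClasses_le_span_hodgeClasses) (hX : Motives.IsSmoothProjective n X)
    (hHM : ∀ (a p : ℕ) (c : complexBetti (cartesianPow X (a + 1)) (2 * p)), c ∈ hodgePowClasses n X a p →
      c ∈ motivatedClasses (cartesianPowDim n a) (cartesianPow X (a + 1)) p) :
    mumfordTateGroup n X = motivatedGaloisGroup n X :=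
  powClassSimilitudeGroup_eq_of_powClassStabilizer_eq
    (hodgeGroup_eq_specialMotivatedGaloisGroup_of_forall_mem_motivatedClasses h hX hHM)

/-- `MT(X) = G_mot(X)` iff `Hg(X) = G¹_mot(X)`, given `Hg ≤ G¹_mot` (hypothesis `h`): both full
groups are `w(ℂˣ) ·` the special ones, and `w(λ) g'` with `g'` in a stabiliser fixes a class of
`H²ᵖ`, `p`-by-`p`, iff `λ²ᵖ = 1` on the classes present — so the special group is recovered inside
the full one as the stabiliser. Only the direction used by the route (`Hg = G¹ ⇒ MT = G`) is
recorded. [folklore] -/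
theorem mumfordTateGroup_eq_motivatedGaloisGroup_of_hodgeGroup_eq (hHg : hodgeGroup n X = specialMotivatedGaloisGroup n X) :
    mumfordTateGroup n X = motivatedGaloisGroup n X :=
  powClassSimilitudeGroup_eq_of_powClassStabilizer_eq hHg

/-- **`Hg(X) = G¹_mot(X)` ⇒ "Hodge ⇒ motivated on `X`"** (the converse direction, through André
§4.6 (ii) = hypothesis `hinv`, the named fact `Andre1996_specialMotivatedGaloisGroup_invariants_le`):
a rational `(p,p)`-class `c` of `X` is fixed by `Hg(X)` (definition), hence by `G¹_mot(X)`, hence is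
motivated. With the previous theorem: "Hodge ⇒ motivated on all powers of `X`" ⟺ `Hg(X^{×a}) =
G¹_mot(X^{×a})` for all `a` — the Tannakian reformulation behind the route's foreseen split
`HM ⟺ [G_mot connected] ∧ [MT = G_mot⁰]`. [cite: Andre1996Motifs, §4.6 (ii) (p. 24) and §6.3 (p. 31)] -/
theorem mem_motivatedClasses_of_hodgeGroup_eq (hinv : Andre1996_specialMotivatedGaloisGroup_invariants_le)
    (hX : Motives.IsSmoothProjective n X) (hHg : hodgeGroup n X = specialMotivatedGaloisGroup n X)
    {p : ℕ} {c : complexBetti X (2 * p)} (hc : IsRationalClass c) (hpp : IsOfHodgeType n X (2 * p) p p c) :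
    c ∈ motivatedClasses n X p :=
  hinv hX p c fun _ hg ↦ apply_eq_self_of_mem_hodgeGroup (hHg ▸ hg) hc hpp

/-! ### Identity component and `π₀`, for `ℂ`-points of algebraic groups -/

section NeutralComponent

variable {Γ : Type*} [Group Γ]

/-- **The neutral (identity) component** of a subgroup `K` of an abstract group, rendered as the
intersection of the subgroups of `K` of finite index in `K`. For `K = 𝒢(ℂ)` the `ℂ`-points of a
linear algebraic group over `ℂ` this IS `𝒢⁰(ℂ)`: `𝒢⁰(ℂ)` has finite index and, being generated by
divisible subgroups (tori `(ℂˣ)ʳ` and one-parameter unipotent subgroups `exp(ℂ N)`, which contain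
`g_s`, resp. `g_u`, of every `g = g_s g_u`), has no proper subgroup of finite index; see the module
docstring, "Connectedness". Intended for `motivatedGaloisGroup n X` and its three companions
(André 1996 Remarque (ii), p. 25: whether `G_mot` is connected is not known). [folklore] -/
def neutralComponent (K : Subgroup Γ) : Subgroup Γ :=
  K ⊓ sInf {H : Subgroup Γ | H ≤ K ∧ (H.subgroupOf K).FiniteIndex}

/-- `K⁰ ≤ K`. [folklore] -/
theorem neutralComponent_le (K : Subgroup Γ) : neutralComponent K ≤ K := inf_le_left

/-- Every finite-index subgroup of `K` contains `K⁰`. [folklore] -/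
theorem neutralComponent_le_of_finiteIndex {K H : Subgroup Γ} (hHK : H ≤ K)
    (hH : (H.subgroupOf K).FiniteIndex) : neutralComponent K ≤ H :=
  inf_le_right.trans (sInf_le ⟨hHK, hH⟩)

/-- Membership in `K⁰`: in `K` and in every finite-index subgroup of `K`. [folklore] -/
theorem mem_neutralComponent_iff {K : Subgroup Γ} {g : Γ} :
    g ∈ neutralComponent K ↔ g ∈ K ∧ ∀ H : Subgroup Γ, H ≤ K → (H.subgroupOf K).FiniteIndex → g ∈ H := by
  simp only [neutralComponent, Subgroup.mem_inf, Subgroup.mem_sInf, Set.mem_setOf_eq, and_imp]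

/-- **Connectedness**, rendered on the abstract group: `K` **is neutral** (= its own neutral
component) — for `K = 𝒢(ℂ)`, `𝒢` linear algebraic over `ℂ`, exactly "`𝒢` is connected". [folklore] -/
def IsNeutral (K : Subgroup Γ) : Prop :=
  neutralComponent K = K

/-- `K` is neutral iff it has no proper subgroup of finite index. [folklore] -/
theorem isNeutral_iff_forall_eq {K : Subgroup Γ} :
    IsNeutral K ↔ ∀ H : Subgroup Γ, H ≤ K → (H.subgroupOf K).FiniteIndex → H = K := by
  constructor
  · intro h H hHK hH
    exact le_antisymm hHK (h.symm.le.trans (neutralComponent_le_of_finiteIndex hHK hH))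
  · intro h
    refine le_antisymm (neutralComponent_le K) (le_inf le_rfl (le_sInf ?_))
    rintro H ⟨hHK, hH⟩
    exact (h H hHK hH).symm.le

/-- **The number of connected components `#π₀`**, rendered as the index of the neutral component
in `K` (`0` if infinite, Mathlib's convention for `Subgroup.relIndex`); for `K = 𝒢(ℂ)` this is
`#π₀(𝒢)`. [folklore] -/
def numComponents (K : Subgroup Γ) : ℕ :=
  (neutralComponent K).relIndex K

/-- A neutral group has one component. [folklore] -/
theorem numComponents_eq_one_of_isNeutral {K : Subgroup Γ} (h : IsNeutral K) : numComponents K = 1 := by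
  rw [numComponents, h, Subgroup.relIndex_self]

/-- Conversely, one component means neutral. [folklore] -/
theorem isNeutral_of_numComponents_eq_one {K : Subgroup Γ} (h : numComponents K = 1) : IsNeutral K :=
  le_antisymm (neutralComponent_le K) (Subgroup.relIndex_eq_one.mp h)

end NeutralComponent

end HodgeTheory

end Literature.AlgebraicGeometry.HodgeTheory

end
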